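import Summits.KontsevichZagierPeriods.KontsevichZagierPeriods.Theorems.LinRedNormalFormBeukersZeta3Charts

/-!
# `BeukersZeta3` (stmt-KontsevichZagierPeriods-3918, route LinRedNormalForm)

Calibration of the unfolded engine at depth one: Beukers' `n = 0` integral
`[(0,1)³, 1/(1 − (1 − xy)z)]` (value `2ζ(3)`) is Kontsevich–Zagier equivalent to the doubled
`ζ(3)` word representation `[1 > t₀ > t₁ > t₂ > 0, 2/(t₀t₁(1 − t₂))]` — `beukersZeta3_proof`.

The move chain, in coordinates `w = (u, x, y)`:

1. change of variables (rule 2) along `Φ₁(x) = (1 − (1 − x₀x₁)x₂, x₀, x₁)` (Jacobian `x₀x₁ − 1`,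
   injective on the open cube): `[(0,1)³, 1/(1−(1−xy)z)] ~ I₁ = [D₁, 1/(u(1−xy))]`,
   `D₁ = {0 < x, y < 1, xy < u < 1}` — the unfolded form of `−log(xy)/(1−xy)`;
2. domain additivity (rule 1a): `D₁ = A ⊔ B̄`, `A = {x < u < 1}`, `B̄ = {xy < u ≤ x}`, and the
   closed face `u = x` of `B̄` is shaved off as a null set (`B = {xy < u < x}`);
3. change of variables along `C₂(w) = (w₂w₀, w₂, w₁)` (Jacobian `−w₂`), a bijection `A → B`
   preserving the integrand `1/(u(1−xy))`: `[A] ~ [B]`, whence `[I₁] ≡ 2[A]`;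
4. change of variables along the cubical-to-simplicial chart `C₃(w) = (w₀, w₁, w₁w₂)`
   (Jacobian `w₁`): `[A] ~ S₁ = [Δ₃, 1/(t₀t₁(1−t₂))]`;
5. integrand additivity (rule 1b): `[Δ₃, 2/(t₀t₁(1−t₂))] = [S₁] + [S₁]`.

All absolute-integrability side conditions are transported from the two GIVEN representations
(the cube integral and the simplex integral), so no convergence estimate is needed; the
semialgebraic side conditions are elementary. This file: images of the charts, the pull-back
identities `g = (h ∘ C)·|J|`, semialgebraicity of the two rational integrands, and the assembly.
Tools (transport lemma, domains, charts) are in `LinRedNormalFormBeukersZeta3Charts.lean`.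

References: F. Beukers, *A note on the irrationality of ζ(2) and ζ(3)*, Bull. LMS 11 (1979), §2;
M. Kontsevich, D. Zagier, *Periods* (2001), §1.1–1.2.
-/

noncomputable section

open Set MeasureTheory MvPolynomial
open Literature.NumberTheory.Transcendental
open Literature.ModelTheory.ExponentialFields (IsSemialgebraic)

namespace Summit.KontsevichZagierPeriods.LinRedNormalForm.BeukersZeta3

/-! ## Images of the charts -/

/-- `Φ₁` maps the open cube onto `D₁` (inverse `x₂ = (1 − u)/(1 − xy)`). [folklore] -/
theorem image_chart1 :
    (fun (x : Fin 3 → ℝ) (i : Fin 3) => aeval x ((![1 - (1 - X 0 * X 1) * X 2, X 0, X 1] : Fin 3 →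
          MvPolynomial (Fin 3) ℚ) i)) '' openUnitCube 3 = {w : Fin 3 → ℝ | 0 < w 1 ∧ w 1 < 1 ∧
          0 < w 2 ∧ w 2 < 1 ∧ w 1 * w 2 < w 0 ∧ w 0 < 1} := by
  ext w
  constructor
  · rintro ⟨x, hx, rfl⟩
    have h0 := hx 0
    have h1 := hx 1
    have h2 := hx 2
    simp only [mem_Ioo] at h0 h1 h2
    simp only [mem_setOf_eq, chart1_apply, Matrix.cons_val_zero, Matrix.cons_val_one,
      Matrix.cons_val_two, Matrix.head_cons, Matrix.tail_cons]
    have hlt : x 0 * x 1 < 1 := by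
      have := mul_lt_of_lt_one_right h0.1 h1.2
      linarith
    have hpos : 0 < 1 - x 0 * x 1 := by linarith
    refine ⟨h0.1, h0.2, h1.1, h1.2, ?_, ?_⟩
    · have := mul_lt_of_lt_one_right hpos h2.2
      nlinarith
    · have := mul_pos hpos h2.1
      linarith
  · rintro ⟨h1, h2, h3, h4, h5, h6⟩
    have hlt : w 1 * w 2 < 1 := by
      have := mul_lt_of_lt_one_right h1 h4
      linarith
    have hpos : 0 < 1 - w 1 * w 2 := by linarith
    refine ⟨![w 1, w 2, (1 - w 0) / (1 - w 1 * w 2)], ?_, ?_⟩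
    · refine mem_openUnitCube_iff.mpr fun i => ?_
      fin_cases i
      · exact ⟨h1, h2⟩
      · exact ⟨h3, h4⟩
      · show (1 - w 0) / (1 - w 1 * w 2) ∈ Set.Ioo (0 : ℝ) 1
        refine ⟨div_pos (by linarith) hpos, ?_⟩
        rw [div_lt_one hpos]
        linarith
    · beta_reduce
      rw [chart1_apply]
      funext i
      fin_cases i
      · show 1 - (1 - w 1 * w 2) * ((1 - w 0) / (1 - w 1 * w 2)) = w 0
        field_simp
        ring
      · simp
      · simp

/-- `C₂` maps `A` onto `B` (inverse `w ↦ (w₀/w₁, w₂, w₁)`). [folklore] -/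
theorem image_chart2 : (fun (x : Fin 3 →
      ℝ) (i : Fin 3) => aeval x ((![X 2 * X 0, X 2, X 1] : Fin 3 →
      MvPolynomial (Fin 3) ℚ) i)) '' {w : Fin 3 → ℝ | 0 < w 1 ∧ w 1 < 1 ∧ 0 < w 2 ∧ w 2 < 1 ∧
      w 1 < w 0 ∧ w 0 < 1} = {w : Fin 3 → ℝ | 0 < w 1 ∧ w 1 < 1 ∧ 0 < w 2 ∧ w 2 < 1 ∧
      w 1 * w 2 < w 0 ∧ w 0 < w 1} := by
  ext v
  constructor
  · rintro ⟨w, ⟨h1, h2, h3, h4, h5, h6⟩, rfl⟩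
    simp only [mem_setOf_eq, chart2_apply, Matrix.cons_val_zero, Matrix.cons_val_one,
      Matrix.cons_val_two, Matrix.head_cons, Matrix.tail_cons]
    refine ⟨h3, h4, h1, h2, ?_, ?_⟩
    · nlinarith
    · nlinarith
  · rintro ⟨h1, h2, h3, h4, h5, h6⟩
    refine ⟨![v 0 / v 1, v 2, v 1], ?_, ?_⟩
    · simp only [mem_setOf_eq, Matrix.cons_val_zero, Matrix.cons_val_one, Matrix.cons_val_two,
        Matrix.head_cons, Matrix.tail_cons]
      refine ⟨h3, h4, h1, h2, ?_, ?_⟩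
      · rw [lt_div_iff₀ h1]
        linarith
      · rw [div_lt_one h1]
        exact h6
    · beta_reduce
      rw [chart2_apply]
      funext i
      fin_cases i
      · show v 1 * (v 0 / v 1) = v 0
        field_simp
      · simp
      · simp

/-- `C₃` maps `A` onto the open ordered simplex (inverse `t ↦ (t₀, t₁, t₂/t₁)`). [folklore] -/
theorem image_chart3 : (fun (x : Fin 3 →
      ℝ) (i : Fin 3) => aeval x ((![X 0, X 1, X 1 * X 2] : Fin 3 →
      MvPolynomial (Fin 3) ℚ) i)) '' {w : Fin 3 → ℝ | 0 < w 1 ∧ w 1 < 1 ∧ 0 < w 2 ∧ w 2 < 1 ∧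
      w 1 < w 0 ∧ w 0 < 1} = {t : Fin 3 → ℝ | 1 > t 0 ∧ t 0 > t 1 ∧ t 1 > t 2 ∧ t 2 > 0} := by
  ext t
  constructor
  · rintro ⟨w, ⟨h1, h2, h3, h4, h5, h6⟩, rfl⟩
    simp only [mem_setOf_eq, chart3_apply, Matrix.cons_val_zero, Matrix.cons_val_one,
      Matrix.cons_val_two, Matrix.head_cons, Matrix.tail_cons, gt_iff_lt]
    refine ⟨h6, h5, ?_, ?_⟩
    · exact mul_lt_of_lt_one_right h1 h4
    · exact mul_pos h1 h3
  · rintro ⟨h1, h2, h3, h4⟩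
    have ht1 : 0 < t 1 := lt_trans h4 h3
    refine ⟨![t 0, t 1, t 2 / t 1], ?_, ?_⟩
    · simp only [mem_setOf_eq, Matrix.cons_val_zero, Matrix.cons_val_one, Matrix.cons_val_two,
        Matrix.head_cons, Matrix.tail_cons]
      refine ⟨ht1, by linarith, div_pos h4 ht1, ?_, h2, h1⟩
      rw [div_lt_one ht1]
      exact h3
    · beta_reduce
      rw [chart3_apply]
      funext i
      fin_cases i
      · simp
      · simp
      · show t 1 * (t 2 / t 1) = t 2
        field_simp

/-! ## Integrand identities (`g = (h ∘ C)·|J|`) and semialgebraic integrands -/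

/-- Pull-back identity for `Φ₁`: `1/(1−(1−xy)z) = 1/(u(1−xy))·|xy − 1|` at `u = Φ₁(x)₀`.
[folklore] -/
theorem hgh_chart1 : ∀ x ∈ openUnitCube 3, (1 / (1 - (1 - x 0 * x 1) * x 2) : ℝ) =
    (fun w : Fin 3 → ℝ => 1 / (w 0 * (1 - w 1 * w 2))) (fun i => aeval x ((![1 - (1 - X 0 * X 1) *
          X 2, X 0, X 1] : Fin 3 → MvPolynomial (Fin 3) ℚ) i)) *
      |aeval x (X 0 * X 1 - 1 : MvPolynomial (Fin 3) ℚ)| := by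
  intro x hx
  rw [chart1_apply]
  have h0 := hx 0
  have h1 := hx 1
  have h2 := hx 2
  simp only [mem_Ioo] at h0 h1 h2
  have hlt : x 0 * x 1 < 1 := by
    have := mul_lt_of_lt_one_right h0.1 h1.2
    linarith
  have hpos : 0 < 1 - x 0 * x 1 := by linarith
  have hden : 0 < 1 - (1 - x 0 * x 1) * x 2 := by
    have := mul_lt_of_lt_one_right hpos h2.2
    nlinarith
  simp only [Matrix.cons_val_zero, Matrix.cons_val_one, Matrix.cons_val_two, Matrix.head_cons,
    Matrix.tail_cons, map_sub, map_mul, aeval_X, map_one]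
  rw [abs_sub_comm, abs_of_pos hpos]
  field_simp

/-- Pull-back identity for `C₂`: the integrand `1/(u(1−xy))` is preserved up to the Jacobian
`|−w₂|`. [folklore] -/
theorem hgh_chart2 : ∀ w ∈ {w : Fin 3 → ℝ | 0 < w 1 ∧ w 1 < 1 ∧ 0 < w 2 ∧ w 2 < 1 ∧ w 1 < w 0 ∧
      w 0 < 1}, (fun w : Fin 3 → ℝ => 1 / (w 0 * (1 - w 1 * w 2))) w =
    (fun w : Fin 3 → ℝ => 1 / (w 0 * (1 - w 1 * w 2))) (fun i => aeval w ((![X 2 * X 0, X 2,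
          X 1] : Fin 3 → MvPolynomial (Fin 3) ℚ) i)) *
      |aeval w (-X 2 : MvPolynomial (Fin 3) ℚ)| := by
  rintro w ⟨h1, h2, h3, h4, h5, h6⟩
  rw [chart2_apply]
  simp only [Matrix.cons_val_zero, Matrix.cons_val_one, Matrix.cons_val_two, Matrix.head_cons,
    Matrix.tail_cons, map_neg, aeval_X, abs_neg]
  rw [abs_of_pos h3]
  have hlt : w 1 * w 2 < 1 := by
    have := mul_lt_of_lt_one_right h1 h4
    linarith
  have hpos : 0 < 1 - w 1 * w 2 := by linarith
  have h0 : 0 < w 0 := lt_trans h1 h5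
  field_simp

/-- Pull-back identity for `C₃`: `1/(u(1−xy)) = 1/(t₀t₁(1−t₂))·|w₁|` at `t = C₃(w)`. [folklore] -/
theorem hgh_chart3 : ∀ w ∈ {w : Fin 3 → ℝ | 0 < w 1 ∧ w 1 < 1 ∧ 0 < w 2 ∧ w 2 < 1 ∧ w 1 < w 0 ∧
      w 0 < 1}, (fun w : Fin 3 → ℝ => 1 / (w 0 * (1 - w 1 * w 2))) w =
    (fun t : Fin 3 → ℝ => 1 / (t 0 * t 1 * (1 - t 2))) (fun i => aeval w ((![X 0, X 1,
          X 1 * X 2] : Fin 3 → MvPolynomial (Fin 3) ℚ) i)) *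
      |aeval w (X 1 : MvPolynomial (Fin 3) ℚ)| := by
  rintro w ⟨h1, h2, h3, h4, h5, h6⟩
  rw [chart3_apply]
  simp only [Matrix.cons_val_zero, Matrix.cons_val_one, Matrix.cons_val_two, Matrix.head_cons,
    Matrix.tail_cons, aeval_X]
  rw [abs_of_pos h1]
  have hlt : w 1 * w 2 < 1 := by
    have := mul_lt_of_lt_one_right h1 h4
    linarith
  have hpos : 0 < 1 - w 1 * w 2 := by linarith
  have h0 : 0 < w 0 := lt_trans h1 h5
  field_simp

/-- The integrand `1/(u(1−xy))` is a `ℚ`-semialgebraic function on `D₁` (a quotient of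
polynomials with non-vanishing denominator). [cite: BochnakCosteRoy1998, §2.2] -/
theorem isSemialgebraicFunOn_h1 :
    IsSemialgebraicFunOn ℚ {w : Fin 3 → ℝ | 0 < w 1 ∧ w 1 < 1 ∧ 0 < w 2 ∧ w 2 < 1 ∧
          w 1 * w 2 < w 0 ∧ w 0 < 1} (fun w : Fin 3 → ℝ => 1 / (w 0 * (1 - w 1 * w 2))) := by
  have hq : ∀ w ∈ {w : Fin 3 → ℝ | 0 < w 1 ∧ w 1 < 1 ∧ 0 < w 2 ∧ w 2 < 1 ∧ w 1 * w 2 < w 0 ∧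
        w 0 < 1}, aeval w (X 0 * (1 - X 1 * X 2) : MvPolynomial (Fin 3) ℚ) ≠ 0 := by
    rintro w ⟨h1, h2, h3, h4, h5, h6⟩
    have hlt : w 1 * w 2 < 1 := by
      have := mul_lt_of_lt_one_right h1 h4
      linarith
    have h0 : 0 < w 0 := by nlinarith
    simp only [map_mul, map_sub, map_one, aeval_X]
    exact mul_ne_zero h0.ne' (by linarith)
  refine (isSemialgebraicFunOn_aeval_div_aeval isSemialgebraic_D1 (1 : MvPolynomial (Fin 3) ℚ)
    (X 0 * (1 - X 1 * X 2)) hq).congr fun w _ => ?_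
  simp

/-- The integrand `1/(t₀t₁(1−t₂))` is a `ℚ`-semialgebraic function on the open simplex.
[cite: BochnakCosteRoy1998, §2.2] -/
theorem isSemialgebraicFunOn_hS :
    IsSemialgebraicFunOn ℚ {t : Fin 3 → ℝ | 1 > t 0 ∧ t 0 > t 1 ∧ t 1 > t 2 ∧
          t 2 > 0} (fun t : Fin 3 → ℝ => 1 / (t 0 * t 1 * (1 - t 2))) := by
  have hq : ∀ t ∈ {t : Fin 3 → ℝ | 1 > t 0 ∧ t 0 > t 1 ∧ t 1 > t 2 ∧
        t 2 > 0}, aeval t (X 0 * X 1 * (1 - X 2) : MvPolynomial (Fin 3) ℚ) ≠ 0 := by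
    rintro t ⟨h1, h2, h3, h4⟩
    have ht1 : 0 < t 1 := lt_trans h4 h3
    have ht0 : 0 < t 0 := lt_trans ht1 h2
    have ht2 : t 2 < 1 := by linarith
    simp only [map_mul, map_sub, map_one, aeval_X]
    exact mul_ne_zero (mul_ne_zero ht0.ne' ht1.ne') (by linarith)
  refine (isSemialgebraicFunOn_aeval_div_aeval isSemialgebraic_DS (1 : MvPolynomial (Fin 3) ℚ)
    (X 0 * X 1 * (1 - X 2)) hq).congr fun t _ => ?_
  simp

/-! ## The theorem -/

/-- **Beukers' `n = 0` integral inside Conjecture 1** (item `BeukersZeta3` of route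
`LinRedNormalForm`): every representation on the open cube `(0,1)³` with integrand
`1/(1 − (1 − x₀x₁)x₂)` there is Kontsevich–Zagier equivalent to every representation on the open
ordered simplex `1 > t₀ > t₁ > t₂ > 0` with integrand `2/(t₀t₁(1 − t₂))` there, by the six-move
chain of the module docstring (three changes of variables, one domain additivity with a null face
shaved off, one integrand additivity). [cite: KontsevichZagier2001, §1.2] -/
theorem beukersZeta3_proof :
    Summit.KontsevichZagierPeriods.KontsevichZagierPeriods.Theses.LinRedNormalForm.BeukersZeta3 :=
  by
  intro r r' hrd hri hr'd hr'i
  -- move 1: change of variables along `Φ₁`, cube → `D₁ = {0 < x, y < 1, xy < u < 1}`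
  have T1 := polyChart_transport _ (X 0 * X 1 - 1) isSemialgebraic_cube3 (fun y _ => det_chart1 y)
    injOn_chart1 (fun x => 1 / (1 - (1 - x 0 * x 1) * x 2))
    (fun w => 1 / (w 0 * (1 - w 1 * w 2))) hgh_chart1
  rw [image_chart1] at T1
  have hri' : EqOn r.integrand (fun x => 1 / (1 - (1 - x 0 * x 1) * x 2)) (openUnitCube 3) :=
    fun x hx => hri (by rw [hrd]; exact hx)
  have hI1int : IntegrableOn (fun w : Fin 3 → ℝ => 1 / (w 0 * (1 - w 1 * w 2))) _ :=
    T1.2.1 r hrd hri'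
  let I1 : KZ.IntegralRep 3 :=
    ⟨_, fun w => 1 / (w 0 * (1 - w 1 * w 2)), isSemialgebraic_D1, isSemialgebraicFunOn_h1, hI1int⟩
  have e1 : KZ.Equivalent r I1 := T1.2.2 r I1 hrd hri' rfl (fun _ _ => rfl)
  -- move 2: domain additivity `D₁ = A ⊔ B̄`, `A = {x < u < 1}`, `B̄ = {xy < u ≤ x}`, and the
  -- null face `B̄ ∖ B`, `B = {xy < u < x}`
  let A : KZ.IntegralRep 3 := I1.restrict _ isSemialgebraic_DA DA_subset_D1
  let Bc : KZ.IntegralRep 3 := I1.restrict _ isSemialgebraic_DBc DBc_subset_D1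
  let B : KZ.IntegralRep 3 := Bc.restrict _ isSemialgebraic_DB DB_subset_DBc
  have e2 : KZ.of I1 - KZ.of A - KZ.of Bc ∈ KZ.relations :=
    KZ.domainAddRel_subset_relations ⟨3, I1, A, Bc, D1_eq_union,
      by rw [KZ.IntegralRep.domain_restrict, KZ.IntegralRep.domain_restrict, DA_inter_DBc,
             measure_empty],
      fun _ _ => rfl, fun _ _ => rfl, rfl⟩
  have e3 : KZ.of Bc - KZ.of B ∈ KZ.relations :=
    Bc.of_sub_of_restrict_mem_relations isSemialgebraic_DB DB_subset_DBc volume_DBc_diff_DB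
  -- move 3: change of variables along `C₂`, `A → B`
  have T2 := polyChart_transport _ (-X 2) isSemialgebraic_DA (fun y _ => det_chart2 y)
    injOn_chart2 (fun w => 1 / (w 0 * (1 - w 1 * w 2)))
    (fun w => 1 / (w 0 * (1 - w 1 * w 2))) hgh_chart2
  rw [image_chart2] at T2
  have e4 : KZ.Equivalent A B := T2.2.2 A B rfl (fun _ _ => rfl) rfl (fun _ _ => rfl)
  -- the halved simplex representation `S₁ = [Δ₃, 1/(t₀t₁(1−t₂))]`
  have hDSm : MeasurableSet {t : Fin 3 → ℝ | 1 > t 0 ∧ t 0 > t 1 ∧ t 1 > t 2 ∧ t 2 > 0} :=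
    Literature.ModelTheory.ExponentialFields.IsSemialgebraic.measurableSet_holds isSemialgebraic_DS
  have hSint : IntegrableOn (fun t : Fin 3 → ℝ => 1 / (t 0 * t 1 * (1 - t 2)))
      {t : Fin 3 → ℝ | 1 > t 0 ∧ t 0 > t 1 ∧ t 1 > t 2 ∧ t 2 > 0} := by
    have h2 : IntegrableOn (fun t : Fin 3 → ℝ => 2 / (t 0 * t 1 * (1 - t 2)))
        {t : Fin 3 → ℝ | 1 > t 0 ∧ t 0 > t 1 ∧ t 1 > t 2 ∧ t 2 > 0} := by
      have := r'.integrableOn.congr_fun hr'i (KZ.IntegralRep.measurableSet_domain_holds r')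
      rwa [hr'd] at this
    have h3 : IntegrableOn (fun t : Fin 3 → ℝ => 1 / 2 * (2 / (t 0 * t 1 * (1 - t 2))))
        {t : Fin 3 → ℝ | 1 > t 0 ∧ t 0 > t 1 ∧ t 1 > t 2 ∧ t 2 > 0} :=
      h2.const_mul (1 / 2 : ℝ)
    exact h3.congr_fun (fun t _ => by ring) hDSm
  let S1 : KZ.IntegralRep 3 :=
    ⟨_, fun t => 1 / (t 0 * t 1 * (1 - t 2)), isSemialgebraic_DS, isSemialgebraicFunOn_hS, hSint⟩
  -- move 4: change of variables along `C₃`, `A → Δ₃`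
  have T3 := polyChart_transport _ (X 1) isSemialgebraic_DA (fun y _ => det_chart3 y)
    injOn_chart3 (fun w => 1 / (w 0 * (1 - w 1 * w 2)))
    (fun t => 1 / (t 0 * t 1 * (1 - t 2))) hgh_chart3
  rw [image_chart3] at T3
  have e5 : KZ.Equivalent A S1 := T3.2.2 A S1 rfl (fun _ _ => rfl) rfl (fun _ _ => rfl)
  -- move 5: integrand additivity `[Δ₃, 2/(…)] = [S₁] + [S₁]`
  have e6 : KZ.of r' - KZ.of S1 - KZ.of S1 ∈ KZ.relations := by
    refine KZ.integrandAddRel_subset_relations ⟨3, r', S1, S1, hr'd.symm, hr'd.symm,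
      fun t ht => ?_, rfl⟩
    rw [hr'i ht]
    show (2 : ℝ) / (t 0 * t 1 * (1 - t 2)) =
      1 / (t 0 * t 1 * (1 - t 2)) + 1 / (t 0 * t 1 * (1 - t 2))
    ring
  -- assemble
  unfold KZ.Equivalent at e1 e4 e5 ⊢
  have key : KZ.of r - KZ.of r' = (KZ.of r - KZ.of I1) + (KZ.of I1 - KZ.of A - KZ.of Bc)
      + (KZ.of Bc - KZ.of B) - (KZ.of A - KZ.of B) + (KZ.of A - KZ.of S1) + (KZ.of A - KZ.of S1)
      - (KZ.of r' - KZ.of S1 - KZ.of S1) := by abel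
  rw [key]
  exact sub_mem (add_mem (add_mem (sub_mem (add_mem (add_mem e1 e2) e3) e4) e5) e5) e6

end Summit.KontsevichZagierPeriods.LinRedNormalForm.BeukersZeta3
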